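import Summits.BirchSwinnertonDyer.BirchSwinnertonDyer.Theorems.AlignedTransportAtTwoBSDOfMainConjectureRankOneAtTwoEulerCharAtTwoKerGObstruction
import Summits.BirchSwinnertonDyer.BirchSwinnertonDyer.Theorems.AlignedTransportAtTwoBSDOfMainConjectureRankOneAtTwoEulerCharAtTwoKerGCount
import Summits.BirchSwinnertonDyer.Rank1Residual.Additive.StrictSignedSelmerPreimageZero
import Literature.NumberTheory.EllipticCurves.SelmerInftyTorsionPowKummerLiftProofs
import HarnessLib

/-!
# Route `AlignedTransportAtTwo`, crux C3′ `BSDOfMainConjectureRankOneAtTwo` (stmt-BirchSwinnertonDyer-23008), line `birth`,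
# the (L) road of the kernel index: VALUES OF GREENBERG'S EMBEDDING ARE POINT-ORTHOGONAL, and the identity
# `#(A₀/Sel₀) · [E(K) : E_𝒦] = ∏_{v∈S} #𝒦_{v,0}[p^∞]` (Greenberg's Lemma 4.7 / Cassels–Poitou–Tate in POSITIVE rank)

HONEST FRAMING (cell `bsd-f1-sign2`, attach seat `bsd-line-att-p3` g11 under the C3′ lead lineage `bsd-line-att-p1`;
`--supports stmt-BirchSwinnertonDyer-23008 --as helper`). BSD is NOT proved; C3′ is NOT closed; nothing is asserted. THEOREMS
ONLY (no `def`, no named fact, no `sorry`). Last step of `Cruxes/BSDOfMainConjectureRankOneAtTwo/KERINDEX-L-ROAD-att-p3-g10.md` §2–§3,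
assembling the sibling files `…KerGCassels` (positive-rank Cassels), `…KerGImage` (image ⊇, reciprocity), `…KerGObstruction` (the
bi-additive obstruction `B`, `ker B ⊆ im Ψ`), `…KerGCount` (finite bilinear count) and att-p3 g10's `…KerGEmbedding`.

* §1 `pointObstructionHom_eq_zero_of_mem_selmerInftyPreimage` — **VALUES OF `Ψ` ARE POINT-ORTHOGONAL** (`im Ψ ⊆ ker B`): for
  `y ∈ A₀ = h₀⁻¹(Sel_{p^∞}(E/K_∞))` with `(loc_v y)_{v∈S} = x`, `B x = 0`. Proof: `p^n y ∈ Sel₀` (its localisations vanish); by the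
  DIVISIBILITY hypothesis on `Sel₀` (`p^e Sel₀ ⊆ p^{n+e} Sel₀`, true when `p^e` kills `Sel₀` modulo its divisible part) replace `y` by
  `y' = y − d` with the same localisations and `p^{n+e} y' = 0`; lift `y'` to a global class `c ∈ H¹(K, E[p^k])` (tree
  `WeierstrassCurve.exists_torsionPowToPrimaryH1Sub_eq` over `Γ_{K_0}`, transported to `Γ_K`); `loc c` is a family of Kummer lifts of
  `x` on `S`, is Kummer at the finite places off `S` (`𝒦_{v,0}[p^∞] = 0` there) and at every infinite place (tree
  `Additive.localResOver_infinitePlace_eq_zero`: infinite places split in `K_∞/K`); so `B x P = ∑_{v∈S} inv_v(loc_v c ∪ₑ loc_v κ(P))`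
  `= ∑_{v∈∞∪S}(…) = 0` by reciprocity (`…KerGImage.sum_invWeilPairing_kummerMapTorsion_eq_zero_of_sub_localization_mem`).
* §2 `exists_pointObstructionHom_natCard_kerG_zero_mul_eq_prod` — **THE (L) IDENTITY**: under the hypotheses of the four files (CYCLOTOMIC
  `κ`, `E(K̄)[p^∞]^{Γ_K} = 0`, `S ⊇ {v ∣ p} ∪ {bad}` with `𝒦_{v,0}[p^∞]` finite and killed by `p^n` on `S`, `k = n + 1 + e`, a Poitou–Tate
  family at level `p^k` with `IsPerfect` ∧ `SumLocalTermEqZero` ∧ `SelmerComplement` — e.g. from the tree THEOREM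
  `poitouTate_selmerStructure_duality_holds` —, a Weil pairing on `E[p^k]`, the level-`p^k` Ш-exponent hypothesis and the `Sel₀`
  divisibility hypothesis) there is a bi-additive `B : ∏_{v∈S} 𝒦_{v,0}[p^∞] →+ (E(K) →+ ℤ/p^k)` computing the point obstruction on every
  family of Kummer lifts, with `E(K)/E_𝒦` finite (`E_𝒦 = ker B.flip`, the points orthogonal to all local classes) and
  **`#(A₀/Sel₀) · #(E(K)/E_𝒦) = ∏_{v∈S} #𝒦_{v,0}[p^∞]`**.

What this does NOT do: identify `[E(K) : E_𝒦]` with a height/regulator quantity ((H) of the road — research), evaluate the local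
orders (Greenberg's Lemmas 3.3/3.4, named facts), or discharge the two exponent hypotheses from `#Ш(E/K)[p^∞] < ∞` (routine: `p^e`
with `p^{e-1} Ш[p^∞] = 0`).

References: [GreenbergLNM1716] §4 p. 104, Lemma 4.7 (pp. 107–108), Appendix Prop. 4.13 (pp. 120–123); [MilneADT2006] I Thm. 4.10,
Lemma 6.15, Thm. 6.13; [Cassels1964ArithmeticVII]; [GreenbergVatsal2000] §2.
bears_on: stmt-BirchSwinnertonDyer-23008 (helper; closes nothing), stmt-BirchSwinnertonDyer-22298 (attach seat's item; untouched).
-/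

set_option autoImplicit false
-- the Theorems namespace of this sub repeats the summit name by design (D-0017 nested layout)
set_option linter.dupNamespace false

noncomputable section

open scoped Classical NumberField

open CategoryTheory Field NumberField IsDedekindDomain Function WeierstrassCurve
open Literature.NumberTheory.EllipticCurves Literature.NumberTheory.EllipticCurves.GreenbergSelmer
open Literature.NumberTheory.GaloisRepresentations
open Literature.NumberTheory.GaloisRepresentations.DiscreteGaloisModule (SelmerStructure unramifiedSubgroup mu MuCarrier)
open Literature.NumberTheory.GaloisCohomology
open scoped ContRepresentation

namespace Summit.BirchSwinnertonDyer.BirchSwinnertonDyer.Theorems.AlignedTransportAtTwoEulerCharAtTwoKerGIndex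

open Summit.BirchSwinnertonDyer.Rank1Residual.X11b Summit.BirchSwinnertonDyer.Rank1Residual.X11b.KummerPT
open Summit.BirchSwinnertonDyer.Rank1Residual.X11b.LocBridge
open Summit.BirchSwinnertonDyer.Rank1Residual.X11b.Levels
open Summit.BirchSwinnertonDyer.Rank1Residual.X11b.AcSelmer
open Summit.BirchSwinnertonDyer.Rank1Residual.X11b.Relaxation
open Summit.BirchSwinnertonDyer.Rank1Residual.X11b.KummerDecomp
open Summit.BirchSwinnertonDyer.BirchSwinnertonDyer.Theorems.SignedEC.CasselsPT
open Summit.BirchSwinnertonDyer.BirchSwinnertonDyer.Theorems.AlignedTransportAtTwoEulerCharAtTwoKerGCassels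
open Summit.BirchSwinnertonDyer.BirchSwinnertonDyer.Theorems.AlignedTransportAtTwoEulerCharAtTwoKerGImage
open Summit.BirchSwinnertonDyer.BirchSwinnertonDyer.Theorems.AlignedTransportAtTwoEulerCharAtTwoKerGObstruction
open Summit.BirchSwinnertonDyer.BirchSwinnertonDyer.Theorems.AlignedTransportAtTwoEulerCharAtTwoKerGCount
open ZpExtension Literature.NumberTheory.EllipticCurves.GreenbergVatsal2000 Summit.BirchSwinnertonDyer.Rank1Residual.X2

/-! ## §1 Values of the embedding are point-orthogonal -/

section Orthogonal

variable {K : Type} [Field K] [NumberField K] (W : WeierstrassCurve K) [W.IsElliptic] (p : ℕ) [hp : Fact p.Prime]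
  (κ : ZpExtension K p) (k : ℕ)
  (ew : W.geomTorsion ((p ^ k : ℕ) : ℤ) → W.geomTorsion ((p ^ k : ℕ) : ℤ) → AlgebraicClosure K)
  (hμ : ∀ S T, ew S T ^ (p ^ k) = 1)
  (hadd₁ : ∀ S₁ S₂ T, ew (S₁ + S₂) T = ew S₁ T * ew S₂ T)
  (hadd₂ : ∀ S T₁ T₂, ew S (T₁ + T₂) = ew S T₁ * ew S T₂)
  (hgal : ∀ (σ : absoluteGaloisGroup K) (S T : W.geomTorsion ((p ^ k : ℕ) : ℤ)), σ • ew S T = ew (σ • S) (σ • T))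
  (halt : ∀ T, ew T T = 1)

set_option maxHeartbeats 2000000 in -- instance-path unifications on the local cohomology groups (see `…KerGCount` §2)
include halt in
/-- **VALUES OF GREENBERG'S EMBEDDING ARE POINT-ORTHOGONAL (`im Ψ ⊆ ker B`).** Every number field `K`, prime `p`, `ℤ_p`-extension `κ`,
finite `S` off which `E` has good reduction and `v ∤ p`; `p^n • 𝒦_{v,0}[p^∞] = 0` on `S`, `k = n + 1 + e`; `inv` with
`SumLocalTermEqZero`, a Weil pairing; `B` any map computing the point obstruction on Kummer lifts
(`…KerGObstruction.exists_pointObstructionHom`); DIVISIBILITY on `Sel₀`: `∀ s ∈ Sel₀, ∃ d ∈ Sel₀, p^e • s = p^{n+e} • d`. Then for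
`y ∈ A₀` with localisations `(loc_v y)_{v∈S} = x`: **`B x = 0`**. See the module docstring for the proof (a level-`p^k` global lift of
`y − d` is a family of Kummer lifts of `x`, Kummer off `S` and at `∞`; reciprocity). [cite: GreenbergLNM1716, §4 p. 104 and Prop. 4.13]
[cite: MilneADT2006, Ch. I, Thm. 4.10(b), Lemma 6.15] [cite: GreenbergLNM1716, §3 p. 86 (infinite places), Lemma 3.3] -/
theorem pointObstructionHom_eq_zero_of_mem_selmerInftyPreimage (S : Finset (HeightOneSpectrum (𝓞 K)))
    (hS : ∀ v ∉ S, ((p : ℕ) : 𝓞 K) ∉ v.asIdeal ∧ W.HasGoodReductionAt v)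
    {n e : ℕ} (hk : n + 1 + e = k)
    (hXn : ∀ v ∈ S, ∀ x ∈ W.localTowerKerPrimary κ (v.adicCompletion K) 0, p ^ n • x = 0)
    {inv : LocalInvariants K (p ^ k)} (hvan : inv.SumLocalTermEqZero)
    (B : (∀ v : S, W.localTowerKerPrimary κ (v.1.adicCompletion K) 0) →+ (W.toAffine.Point →+ ZMod (p ^ k)))
    (hB : ∀ (x : ∀ v : S, W.localTowerKerPrimary κ (v.1.adicCompletion K) 0)
        (t : Π v : Place K, galoisCohomology ((W.torsionGaloisModule ((p ^ k : ℕ) : ℤ)).toLocal v) 1),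
        (∀ v : S,
          resH1Hom (Literature.NumberTheory.EllipticCurves.subgroupIncl
              (localSubgroup (⊤ : Subgroup (absoluteGaloisGroup K)) (v.1.adicCompletion K)))
            (AddMonoidHom.id (localPoints W (v.1.adicCompletion K))) (fun _ _ ↦ rfl)
            (galoisCohomology.map (W.torsionPointsMapIntertwining ((p ^ k : ℕ) : ℤ) (v.1.adicCompletion K)) 1
              (t (Sum.inr v.1))) =
          Literature.NumberTheory.EllipticCurves.resOfLe (localPoints W (v.1.adicCompletion K))
            (localSubgroup_top_le_layerSubgroup_zero κ (v.1.adicCompletion K))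
            ((x v : W.localTowerKerPrimary κ (v.1.adicCompletion K) 0) :
              discreteH1 (localSubgroup (κ.layerSubgroup 0) (v.1.adicCompletion K))
                (localPoints W (v.1.adicCompletion K)))) →
        ∀ P : W.toAffine.Point,
          B x P = ∑ u ∈ S, invWeilPairing W (p ^ k) ew hμ hadd₁ hadd₂ hgal inv (Sum.inr u) (t (Sum.inr u))
            (galoisCohomology.localization (W.torsionGaloisModule ((p ^ k : ℕ) : ℤ)) (Sum.inr u) 1
              (kummerMapTorsion W ((p ^ k : ℕ) : ℤ)
                (W.zsmul_geomPoints_surjective_holds (natCast_pow_ne_zero p k)) P)))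
    (hdiv : ∀ s ∈ W.selmerLayer κ 0, ∃ d ∈ W.selmerLayer κ 0, p ^ e • s = p ^ (n + e) • d)
    {y : W.subgroupH1 p (κ.layerSubgroup 0)} (hy : y ∈ W.selmerInftyPreimage κ 0)
    {x : ∀ v : S, W.localTowerKerPrimary κ (v.1.adicCompletion K) 0}
    (hyx : ∀ v : S, W.localResOver p (κ.layerSubgroup 0) (v.1.adicCompletion K) y =
      ((x v : W.localTowerKerPrimary κ (v.1.adicCompletion K) 0) :
        discreteH1 (localSubgroup (κ.layerSubgroup 0) (v.1.adicCompletion K)) (localPoints W (v.1.adicCompletion K)))) :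
    B x = 0 := by
  have hprime : p.Prime := Fact.out
  haveI : NeZero (p ^ k) := ⟨pow_ne_zero k hprime.ne_zero⟩
  have hNz : ((p ^ k : ℕ) : ℤ) ≠ 0 := natCast_pow_ne_zero p k
  -- notation
  let A : AddSubgroup (W.subgroupH1 p (κ.layerSubgroup 0)) := W.selmerInftyPreimage κ 0
  let Sel₀ : AddSubgroup (W.subgroupH1 p (κ.layerSubgroup 0)) := W.selmerLayer κ 0
  let loc₀ : ∀ v : HeightOneSpectrum (𝓞 K), W.subgroupH1 p (κ.layerSubgroup 0) →+
      discreteH1 (localSubgroup (κ.layerSubgroup 0) (v.adicCompletion K)) (localPoints W (v.adicCompletion K)) :=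
    fun v ↦ W.localResOver p (κ.layerSubgroup 0) (v.adicCompletion K)
  have hone : ∀ z : W.subgroupH1 p (κ.layerSubgroup 0), W.conjH1 p (κ.layerSubgroup 0) 1 z = z := fun z ↦ by
    rw [W.conjH1_one_holds p (κ.layerSubgroup 0), AddMonoidHom.id_apply]
  have h0 : ∀ v ∉ S, W.localTowerKerPrimary κ (v.adicCompletion K) 0 = ⊥ := fun v hv ↦
    Greenberg1999.localTowerKerPrimary_eq_bot_of_hasGoodReductionAt W κ (hS v hv).1 (hS v hv).2 0
  -- localisations of classes of `Sel₀` vanish; of classes of `A₀` lie in `𝒦_{v,0}[p^∞]`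
  have hlocSel : ∀ d ∈ Sel₀, ∀ v, loc₀ v d = 0 := fun d hd v ↦ by
    have h := ((W.mem_selmerGroupOver_iff p (κ.layerSubgroup 0) _).mp hd).1 v 1
    rwa [hone, mem_localKerOver_iff] at h
  have hmemT : ∀ z ∈ A, ∀ v, loc₀ v z ∈ W.localTowerKerPrimary κ (v.adicCompletion K) 0 := by
    intro z hz v
    obtain ⟨m, hm⟩ := W.exists_pow_smul_subgroupH1_layer_eq_zero κ 0 z
    refine (W.mem_localTowerKerPrimary_iff κ _ 0 _).mpr ⟨?_, m, by rw [← map_nsmul, hm, map_zero]⟩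
    have h := W.localResOver_conjH1_mem_localTowerKer_of_mem κ hz v 1
    rwa [hone] at h
  -- (1) `p^n • y ∈ Sel₀`
  have hny : p ^ n • y ∈ Sel₀ := by
    refine W.mem_selmerLayer_of_forall_localResOver_conjH1_eq_zero κ S h0 (fun _ ↦ {1}) (fun v _ σ ↦ ?_)
      (A.nsmul_mem hy (p ^ n)) ?_
    · refine ⟨1, Finset.mem_singleton_self _, 1, σ, ?_, by rw [map_one, one_mul, one_mul]⟩
      rw [ZpExtension.layerSubgroup_zero]; exact Subgroup.mem_top σ
    · intro v hv ρ hρ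
      rw [Finset.mem_singleton] at hρ
      rw [hρ, hone, map_nsmul]
      change p ^ n • loc₀ v y = 0
      rw [hyx ⟨v, hv⟩]
      exact hXn v hv _ (x ⟨v, hv⟩).2
  -- (2) the representative `y' = y - d`, killed by `p^k`, with the same localisations
  obtain ⟨d, hd, hde⟩ := hdiv _ hny
  set y' : W.subgroupH1 p (κ.layerSubgroup 0) := y - d with hy'def
  have hy'A : y' ∈ A := A.sub_mem hy (W.selmerLayer_le_selmerInftyPreimage κ 0 hd)
  have hy'k : p ^ k • y' = 0 := by
    refine pow_nsmul_eq_zero_of_le p (show n + e ≤ k by omega) _ ?_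
    rw [hy'def, smul_sub, ← hde, pow_add, mul_comm, mul_smul, sub_self]
  have hy'x : ∀ v : S, loc₀ v.1 y' = ((x v : W.localTowerKerPrimary κ (v.1.adicCompletion K) 0) : _) := fun v ↦ by
    rw [hy'def, map_sub, hlocSel d hd, sub_zero]; exact hyx v
  have hy'0 : ∀ v ∉ S, loc₀ v y' = 0 := fun v hv ↦
    Summit.BirchSwinnertonDyer.Rank1Residual.Additive.localResOver_eq_zero_of_hasGoodReductionAt W κ
      ((W.mem_selmerInftyPreimage_iff κ 0 _).mp hy'A) v (hS v hv).1 (hS v hv).2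
  have hy'inf : ∀ w : InfinitePlace K, W.localResOver p (κ.layerSubgroup 0) w.Completion y' = 0 := fun w ↦
    Summit.BirchSwinnertonDyer.Rank1Residual.Additive.localResOver_infinitePlace_eq_zero W κ
      ((W.mem_selmerInftyPreimage_iff κ 0 _).mp hy'A) w
  -- (3) a global class `c ∈ H¹(K, E[p^k])` lifting `y'`
  obtain ⟨z, hz⟩ := W.exists_torsionPowToPrimaryH1Sub_eq p (κ.layerSubgroup 0) k W.zsmul_geomPoints_surjective_holds hy'k
  have hres₀ := bijective_resH1Hom_subgroupIncl (W.geomTorsion ((p ^ k : ℕ) : ℤ)) (κ.layerSubgroup 0)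
    (fun g ↦ by rw [ZpExtension.layerSubgroup_zero]; exact Subgroup.mem_top g)
  obtain ⟨c, hc⟩ : ∃ c : galoisCohomology (W.torsionGaloisModule ((p ^ k : ℕ) : ℤ)) 1,
      resH1Hom (Literature.NumberTheory.EllipticCurves.subgroupIncl (κ.layerSubgroup 0))
        (AddMonoidHom.id (W.geomTorsion ((p ^ k : ℕ) : ℤ))) (fun _ _ ↦ rfl) c = z := hres₀.2 z
  -- `yT = res_⊤ ι_* c` restricts to `y'` on `Γ_{K_0}`
  set yT : W.subgroupH1 p (⊤ : Subgroup (absoluteGaloisGroup K)) :=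
    resH1Hom (Literature.NumberTheory.EllipticCurves.subgroupIncl (⊤ : Subgroup (absoluteGaloisGroup K)))
      (AddMonoidHom.id (W.geomPrimaryTorsion p)) (fun _ _ ↦ rfl) (torsionPowToPrimaryH1 W p k c) with hyTdef
  have hyT : W.resOfLe p (le_top : κ.layerSubgroup 0 ≤ ⊤) yT = y' := by
    rw [← hz, ← hc, hyTdef]
    simp only [WeierstrassCurve.resOfLe, Literature.NumberTheory.EllipticCurves.resOfLe, torsionPowToPrimaryH1,
      resH1Hom_resH1Hom]
    exact DFunLike.congr_fun (resH1Hom_congr (by ext; rfl) (by ext; rfl) _ _) c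
  -- local restrictions of `c`: at a finite place `u` and at an infinite place `w`, `res(κ(res c))` restricted to
  -- `(Γ_{K_u} → Γ_K)⁻¹(Γ_{K_0})` is `loc y'`
  have hleL : ∀ (E : Type) [Field E] [Algebra K E],
      localSubgroup (κ.layerSubgroup 0) E ≤ localSubgroup (⊤ : Subgroup (absoluteGaloisGroup K)) E :=
    fun E _ _ ↦ Subgroup.comap_mono le_top
  have hge : ∀ (E : Type) [Field E] [Algebra K E],
      localSubgroup (⊤ : Subgroup (absoluteGaloisGroup K)) E ≤ localSubgroup (κ.layerSubgroup 0) E :=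
    fun E _ _ ↦ localSubgroup_top_le_layerSubgroup_zero κ E
  have hloccF : ∀ u : HeightOneSpectrum (𝓞 K),
      resH1Hom (Literature.NumberTheory.EllipticCurves.subgroupIncl
          (localSubgroup (⊤ : Subgroup (absoluteGaloisGroup K)) (u.adicCompletion K)))
        (AddMonoidHom.id (localPoints W (u.adicCompletion K))) (fun _ _ ↦ rfl)
        (galoisCohomology.map (W.torsionPointsMapIntertwining ((p ^ k : ℕ) : ℤ) (u.adicCompletion K)) 1
          (galoisCohomology.res (W.torsionGaloisModule ((p ^ k : ℕ) : ℤ)) (u.adicCompletion K) 1 c)) =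
      Literature.NumberTheory.EllipticCurves.resOfLe (localPoints W (u.adicCompletion K)) (hge (u.adicCompletion K))
        (loc₀ u y') := by
    intro u
    rw [← localResOver_top_res_torsionPowToPrimaryH1 W p k (u.adicCompletion K) c, ← hyT]
    change _ = Literature.NumberTheory.EllipticCurves.resOfLe (localPoints W (u.adicCompletion K)) (hge (u.adicCompletion K))
      (W.localResOverOfEmb p (κ.layerSubgroup 0) (closureEmb (K := K) (u.adicCompletion K))
        (W.resOfLe p (le_top : κ.layerSubgroup 0 ≤ ⊤) yT))
    rw [W.localResOverOfEmb_resOfLe p (closureEmb (K := K) (u.adicCompletion K)) (le_top : κ.layerSubgroup 0 ≤ ⊤) yT]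
    change W.localResOver p ⊤ (u.adicCompletion K) yT =
      Literature.NumberTheory.EllipticCurves.resOfLe (localPoints W (u.adicCompletion K)) (hge (u.adicCompletion K))
        (Literature.NumberTheory.EllipticCurves.resOfLe (localPoints W (u.adicCompletion K)) (hleL (u.adicCompletion K))
          (W.localResOver p ⊤ (u.adicCompletion K) yT))
    have e1 := congrArg (fun f ↦ f (W.localResOver p ⊤ (u.adicCompletion K) yT))
      (Literature.NumberTheory.EllipticCurves.resOfLe_comp_holds (M := localPoints W (u.adicCompletion K))
        (hge (u.adicCompletion K)) (hleL (u.adicCompletion K)))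
    have e2 := congrArg (fun f ↦ f (W.localResOver p ⊤ (u.adicCompletion K) yT))
      (Literature.NumberTheory.EllipticCurves.resOfLe_refl_holds (M := localPoints W (u.adicCompletion K))
        (localSubgroup (⊤ : Subgroup (absoluteGaloisGroup K)) (u.adicCompletion K)))
    exact (e1.trans e2).symm
  have hloccI : ∀ w : InfinitePlace K,
      resH1Hom (Literature.NumberTheory.EllipticCurves.subgroupIncl
          (localSubgroup (⊤ : Subgroup (absoluteGaloisGroup K)) w.Completion))
        (AddMonoidHom.id (localPoints W w.Completion)) (fun _ _ ↦ rfl)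
        (galoisCohomology.map (W.torsionPointsMapIntertwining ((p ^ k : ℕ) : ℤ) w.Completion) 1
          (galoisCohomology.res (W.torsionGaloisModule ((p ^ k : ℕ) : ℤ)) w.Completion 1 c)) =
      Literature.NumberTheory.EllipticCurves.resOfLe (localPoints W w.Completion) (hge w.Completion)
        (W.localResOver p (κ.layerSubgroup 0) w.Completion y') := by
    intro w
    rw [← localResOver_top_res_torsionPowToPrimaryH1 W p k w.Completion c, ← hyT]
    change _ = Literature.NumberTheory.EllipticCurves.resOfLe (localPoints W w.Completion) (hge w.Completion)
      (W.localResOverOfEmb p (κ.layerSubgroup 0) (closureEmb (K := K) w.Completion)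
        (W.resOfLe p (le_top : κ.layerSubgroup 0 ≤ ⊤) yT))
    rw [W.localResOverOfEmb_resOfLe p (closureEmb (K := K) w.Completion) (le_top : κ.layerSubgroup 0 ≤ ⊤) yT]
    change W.localResOver p ⊤ w.Completion yT =
      Literature.NumberTheory.EllipticCurves.resOfLe (localPoints W w.Completion) (hge w.Completion)
        (Literature.NumberTheory.EllipticCurves.resOfLe (localPoints W w.Completion) (hleL w.Completion)
          (W.localResOver p ⊤ w.Completion yT))
    have e1 := congrArg (fun f ↦ f (W.localResOver p ⊤ w.Completion yT))
      (Literature.NumberTheory.EllipticCurves.resOfLe_comp_holds (M := localPoints W w.Completion)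
        (hge w.Completion) (hleL w.Completion))
    have e2 := congrArg (fun f ↦ f (W.localResOver p ⊤ w.Completion yT))
      (Literature.NumberTheory.EllipticCurves.resOfLe_refl_holds (M := localPoints W w.Completion)
        (localSubgroup (⊤ : Subgroup (absoluteGaloisGroup K)) w.Completion))
    exact (e1.trans e2).symm
  -- hence `loc_v c ∈ 𝓛_v` wherever `loc y' = 0`
  have hkumF : ∀ u : HeightOneSpectrum (𝓞 K), loc₀ u y' = 0 →
      galoisCohomology.localization (W.torsionGaloisModule ((p ^ k : ℕ) : ℤ)) (Sum.inr u) 1 c ∈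
        W.kummerSelmerStructure ((p ^ k : ℕ) : ℤ) (Sum.inr u) := by
    intro u hu
    have hbij := bijective_resH1Hom_subgroupIncl (localPoints W (u.adicCompletion K))
      (localSubgroup (⊤ : Subgroup (absoluteGaloisGroup K)) (u.adicCompletion K)) mem_localSubgroup_top
    change galoisCohomology.map (W.torsionPointsMapIntertwining ((p ^ k : ℕ) : ℤ) (u.adicCompletion K)) 1
      (galoisCohomology.res (W.torsionGaloisModule ((p ^ k : ℕ) : ℤ)) (u.adicCompletion K) 1 c) = 0
    refine hbij.1 ?_
    rw [hloccF u, hu, map_zero]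
    exact (map_zero _).symm
  have hkumI : ∀ w : InfinitePlace K,
      galoisCohomology.localization (W.torsionGaloisModule ((p ^ k : ℕ) : ℤ)) (Sum.inl w) 1 c ∈
        W.kummerSelmerStructure ((p ^ k : ℕ) : ℤ) (Sum.inl w) := by
    intro w
    have hbij := bijective_resH1Hom_subgroupIncl (localPoints W w.Completion)
      (localSubgroup (⊤ : Subgroup (absoluteGaloisGroup K)) w.Completion) mem_localSubgroup_top
    change galoisCohomology.map (W.torsionPointsMapIntertwining ((p ^ k : ℕ) : ℤ) w.Completion) 1
      (galoisCohomology.res (W.torsionGaloisModule ((p ^ k : ℕ) : ℤ)) w.Completion 1 c) = 0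
    refine hbij.1 ?_
    rw [hloccI w, hy'inf w, map_zero]
    exact (map_zero _).symm
  -- `c` is Kummer outside `∞ ∪ S`
  obtain ⟨S', hS'def⟩ : ∃ S' : Finset (Place K), S' = Finset.univ.image Sum.inl ∪ S.image Sum.inr := ⟨_, rfl⟩
  have hcout : c ∈ kummerOutside W (p ^ k) S' := by
    refine (mem_kummerOutside_iff W (p ^ k) S' c).mpr ?_
    rintro (w | u) hv
    · exact absurd (by rw [hS'def]; simp) hv
    · have hu : u ∉ S := fun h ↦ hv (by rw [hS'def]; simp [h])
      exact hkumF u (hy'0 u hu)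
  -- reciprocity with the lifts `t = loc c`
  have hrec := fun P ↦ sum_invWeilPairing_kummerMapTorsion_eq_zero_of_sub_localization_mem W p k ew hμ hadd₁ hadd₂ hgal halt
    hvan S' hcout (fun v ↦ galoisCohomology.localization (W.torsionGaloisModule ((p ^ k : ℕ) : ℤ)) v 1 c)
    (fun v _ ↦ by rw [sub_self]; exact zero_mem _) P
  -- `loc c` is a family of Kummer lifts of `x` on `S`
  have hlift : ∀ v : S,
      resH1Hom (Literature.NumberTheory.EllipticCurves.subgroupIncl
          (localSubgroup (⊤ : Subgroup (absoluteGaloisGroup K)) (v.1.adicCompletion K)))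
        (AddMonoidHom.id (localPoints W (v.1.adicCompletion K))) (fun _ _ ↦ rfl)
        (galoisCohomology.map (W.torsionPointsMapIntertwining ((p ^ k : ℕ) : ℤ) (v.1.adicCompletion K)) 1
          (galoisCohomology.localization (W.torsionGaloisModule ((p ^ k : ℕ) : ℤ)) (Sum.inr v.1) 1 c)) =
      Literature.NumberTheory.EllipticCurves.resOfLe (localPoints W (v.1.adicCompletion K))
        (localSubgroup_top_le_layerSubgroup_zero κ (v.1.adicCompletion K))
        ((x v : W.localTowerKerPrimary κ (v.1.adicCompletion K) 0) : _) := fun v ↦ by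
    rw [← hy'x v]
    exact hloccF v.1
  -- conclusion
  ext P
  rw [hB x (fun v ↦ galoisCohomology.localization (W.torsionGaloisModule ((p ^ k : ℕ) : ℤ)) v 1 c) hlift P,
    AddMonoidHom.zero_apply]
  have h := hrec P
  rw [hS'def, sum_image_inl_union_image_inr] at h
  have hA : ∑ w : InfinitePlace K, invWeilPairing W (p ^ k) ew hμ hadd₁ hadd₂ hgal inv (Sum.inl w)
      (galoisCohomology.localization (W.torsionGaloisModule ((p ^ k : ℕ) : ℤ)) (Sum.inl w) 1 c)
      (galoisCohomology.localization (W.torsionGaloisModule ((p ^ k : ℕ) : ℤ)) (Sum.inl w) 1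
        (kummerMapTorsion W ((p ^ k : ℕ) : ℤ) (W.zsmul_geomPoints_surjective_holds (natCast_pow_ne_zero p k)) P)) = 0 :=
    Finset.sum_eq_zero fun w _ ↦ invWeilPairing_eq_zero_of_mem W (p ^ k) ew hμ hadd₁ hadd₂ hgal halt inv (Sum.inl w)
      (hkumI w) (localization_kummerMapTorsion_mem W (p ^ k) (Sum.inl w) P)
  rw [hA, zero_add] at h
  exact h

end Orthogonal


/-! ## §2 The (L) identity -/

section Identity

variable {K : Type} [Field K] [NumberField K] (W : WeierstrassCurve K) [W.IsElliptic] (p : ℕ) [hp : Fact p.Prime]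
  (κ : ZpExtension K p) (k : ℕ)
  (ew : W.geomTorsion ((p ^ k : ℕ) : ℤ) → W.geomTorsion ((p ^ k : ℕ) : ℤ) → AlgebraicClosure K)
  (hμ : ∀ S T, ew S T ^ (p ^ k) = 1)
  (hadd₁ : ∀ S₁ S₂ T, ew (S₁ + S₂) T = ew S₁ T * ew S₂ T)
  (hadd₂ : ∀ S T₁ T₂, ew S (T₁ + T₂) = ew S T₁ * ew S T₂)
  (hgal : ∀ (σ : absoluteGaloisGroup K) (S T : W.geomTorsion ((p ^ k : ℕ) : ℤ)), σ • ew S T = ew (σ • S) (σ • T))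
  (halt : ∀ T, ew T T = 1) (hnondeg : ∀ T, (∀ S, ew S T = 1) → T = 0)

set_option maxHeartbeats 2000000 in -- as above
include halt hnondeg in
/-- **THE (L) IDENTITY `#(A₀/Sel₀) · [E(K) : E_𝒦] = ∏_{v∈S} #𝒦_{v,0}[p^∞]` (Greenberg LNM 1716 Lemma 4.7 / Cassels–Poitou–Tate in
POSITIVE rank).** `K` a number field, `κ` the CYCLOTOMIC `ℤ_p`-extension, `E(K̄)[p^∞]^{Γ_K} = 0`, `S` finite with good reduction and
`v ∤ p` off `S` and `𝒦_{v,0}[p^∞]` finite and killed by `p^n` on `S`; a level `p^k`, `k = n + 1 + e`, a family `inv` of local invariants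
with `IsPerfect`, `SumLocalTermEqZero`, `SelmerComplement` (the tree THEOREM `poitouTate_selmerStructure_duality_holds` supplies one at
every level), a Weil pairing on `E[p^k]`; the Ш-exponent hypothesis at level `p^k` and the divisibility hypothesis on `Sel₀` (both hold
with `p^{e-1} Ш(E/K)[p^∞] = 0`). THEN there is a bi-additive `B : ∏_{v∈S} 𝒦_{v,0}[p^∞] →+ (E(K) →+ ℤ/p^k)` computing the point obstruction
`∑_{v∈S} inv_v(t_v ∪ₑ loc_v κ_{p^k}(P))` on EVERY family of Kummer lifts, `E(K)/E_𝒦` is finite for `E_𝒦 = ker B.flip` (the points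
orthogonal to all local classes), and **`#(A₀/Sel₀) · #(E(K)/E_𝒦) = ∏_{v∈S} #𝒦_{v,0}[p^∞]`**. In rank `0` (`E_𝒦 = E(K)`) this is the tree's
`InputsGreenbergKerG.natCard_kerG_zero_eq_prod`. [cite: GreenbergLNM1716, §4 p. 104, Lemma 4.7 (pp. 107–108), Prop. 4.13 (pp. 120–123)]
[cite: MilneADT2006, Ch. I, Thm. 4.10, Lemma 6.15, Thm. 6.13] [cite: Cassels1964ArithmeticVII, Thm.] -/
theorem exists_pointObstructionHom_natCard_kerG_zero_mul_eq_prod (hκ : κ.IsCyclotomic)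
    (hE0 : Nat.card (MulAction.fixedPoints (absoluteGaloisGroup K) (W.geomPrimaryTorsion p)) = 1)
    (S : Finset (HeightOneSpectrum (𝓞 K)))
    (hS : ∀ v ∉ S, ((p : ℕ) : 𝓞 K) ∉ v.asIdeal ∧ W.HasGoodReductionAt v)
    (hfin : ∀ v ∈ S, Finite (W.localTowerKerPrimary κ (v.adicCompletion K) 0))
    {n e : ℕ} (hk : n + 1 + e = k)
    (hXn : ∀ v ∈ S, ∀ x ∈ W.localTowerKerPrimary κ (v.adicCompletion K) 0, p ^ n • x = 0)
    {inv : LocalInvariants K (p ^ k)} (hperf : inv.IsPerfect) (hvan : inv.SumLocalTermEqZero)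
    (hcompl : inv.SelmerComplement)
    (hSha : ∀ c : galoisCohomology (W.torsionGaloisModule ((p ^ k : ℕ) : ℤ)) 1,
      (∀ v : HeightOneSpectrum (𝓞 K),
        galoisCohomology.localization (W.torsionGaloisModule ((p ^ k : ℕ) : ℤ)) (Sum.inr v) 1 c ∈
          W.kummerSelmerStructure ((p ^ k : ℕ) : ℤ) (Sum.inr v)) →
      p ^ e • c ∈ (kummerMapTorsion W ((p ^ k : ℕ) : ℤ)
        (W.zsmul_geomPoints_surjective_holds (natCast_pow_ne_zero p k))).range)
    (hdiv : ∀ s ∈ W.selmerLayer κ 0, ∃ d ∈ W.selmerLayer κ 0, p ^ e • s = p ^ (n + e) • d) :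
    ∃ B : (∀ v : S, W.localTowerKerPrimary κ (v.1.adicCompletion K) 0) →+ (W.toAffine.Point →+ ZMod (p ^ k)),
      (∀ (x : ∀ v : S, W.localTowerKerPrimary κ (v.1.adicCompletion K) 0)
        (t : Π v : Place K, galoisCohomology ((W.torsionGaloisModule ((p ^ k : ℕ) : ℤ)).toLocal v) 1),
        (∀ v : S,
          resH1Hom (Literature.NumberTheory.EllipticCurves.subgroupIncl
              (localSubgroup (⊤ : Subgroup (absoluteGaloisGroup K)) (v.1.adicCompletion K)))
            (AddMonoidHom.id (localPoints W (v.1.adicCompletion K))) (fun _ _ ↦ rfl)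
            (galoisCohomology.map (W.torsionPointsMapIntertwining ((p ^ k : ℕ) : ℤ) (v.1.adicCompletion K)) 1
              (t (Sum.inr v.1))) =
          Literature.NumberTheory.EllipticCurves.resOfLe (localPoints W (v.1.adicCompletion K))
            (localSubgroup_top_le_layerSubgroup_zero κ (v.1.adicCompletion K))
            ((x v : W.localTowerKerPrimary κ (v.1.adicCompletion K) 0) :
              discreteH1 (localSubgroup (κ.layerSubgroup 0) (v.1.adicCompletion K))
                (localPoints W (v.1.adicCompletion K)))) →
        ∀ P : W.toAffine.Point,
          B x P = ∑ u ∈ S, invWeilPairing W (p ^ k) ew hμ hadd₁ hadd₂ hgal inv (Sum.inr u) (t (Sum.inr u))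
            (galoisCohomology.localization (W.torsionGaloisModule ((p ^ k : ℕ) : ℤ)) (Sum.inr u) 1
              (kummerMapTorsion W ((p ^ k : ℕ) : ℤ)
                (W.zsmul_geomPoints_surjective_holds (natCast_pow_ne_zero p k)) P))) ∧
      Finite (W.toAffine.Point ⧸ B.flip.ker) ∧
      Nat.card (W.KerG κ 0) * Nat.card (W.toAffine.Point ⧸ B.flip.ker) =
        ∏ v ∈ S, Nat.card (W.localTowerKerPrimary κ (v.adicCompletion K) 0) := by
  obtain ⟨B, hB⟩ := exists_pointObstructionHom W p κ k ew hμ hadd₁ hadd₂ hgal halt S (show n ≤ k by omega) hXn inv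
  have hker : ∀ x : ∀ v : S, W.localTowerKerPrimary κ (v.1.adicCompletion K) 0,
      B x = 0 ↔ ∃ y ∈ W.selmerInftyPreimage κ 0, ∀ v : S,
        W.localResOver p (κ.layerSubgroup 0) (v.1.adicCompletion K) y =
          ((x v : W.localTowerKerPrimary κ (v.1.adicCompletion K) 0) :
            discreteH1 (localSubgroup (κ.layerSubgroup 0) (v.1.adicCompletion K)) (localPoints W (v.1.adicCompletion K))) :=
    fun x ↦ ⟨fun hx ↦ exists_mem_selmerInftyPreimage_of_pointObstructionHom_eq_zero W p κ k ew hμ hadd₁ hadd₂ hgal halt hnondeg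
        hκ hE0 S hS hk hXn hperf hcompl hSha B hB hx,
      fun ⟨_, hy, hyx⟩ ↦ pointObstructionHom_eq_zero_of_mem_selmerInftyPreimage W p κ k ew hμ hadd₁ hadd₂ hgal halt S hS hk hXn
        hvan B hB hdiv hy hyx⟩
  exact ⟨B, hB, natCard_kerG_zero_mul_natCard_quotient_eq_prod_of_ker_eq_of_good W p κ S hS hfin B hker⟩

end Identity

end Summit.BirchSwinnertonDyer.BirchSwinnertonDyer.Theorems.AlignedTransportAtTwoEulerCharAtTwoKerGIndex

end
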